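import Summits.CriticalPhenomena.PercolationContinuityZ3.Theses.PercExchangeRateTransport

/-!
# Sketch (ideator 2, crux-ideate round 1) — crux `PercExchangeRateTransport.CurveInvariance`
(stmt-CriticalPhenomena-16068)

No idea card is filed by this seat (the crux is closed at line level: `Lines/max_reparam.lean`,
`CurveInvariance_proof`, re-verified rc 0 / 0 sorries).  This file only TYPES, over the abstract
data `(Θ, θ, pc)` that the proved core `curveInvariance_core` consumes, the three statements of the
ideator-2 report §3 so that the cdisprove seat has exact targets:

* `CoreNeedsSub`  — the core's hypotheses minus the K⁻-shape do not give curve invariance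
                     (paper witness: travelling wave with increasing jump, report §3(b));
* `CoreNeedsSup`  — mirror statement for the K⁺-shape;
* `CoreAdmitsJump` — the core's hypotheses WITH both shapes are satisfiable together with a
                     positive critical jump (travelling wave with constant jump, report §3(a)), so
                     "J constant" — not "J = 0" — is the right strength for the crux and the route's
                     planar anchor is load-bearing.

Nothing here is proved; every `def` is a `Prop`.
-/

namespace Summit.CriticalPhenomena.PercolationContinuityZ3.Cruxes.CurveInvariance.Ideator2

open Summit.CriticalPhenomena.PercolationContinuityZ3.Theses.PercExchangeRateTransport

/-- The ModelFacts-type and CriticalCurveRegular-type clauses actually consumed by `curveInvariance_core`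
(birth / max_reparam lines), over abstract `Θ n p t`, `θ = ⨅ n Θ n`, threshold curve `pc`. -/
def CoreHypotheses (Θ : ℕ → ℝ → ℝ → ℝ) (θ : ℝ → ℝ → ℝ) (pc : ℝ → ℝ) : Prop :=
  (∀ p t, θ p t = ⨅ n, Θ n p t) ∧
  (∀ t, pc t = sInf ({p : ℝ | 0 ≤ p ∧ p ≤ 1 ∧ 0 < θ p t} ∪ {1})) ∧
  (∀ n, ContDiffOn ℝ 1 (fun x : ℝ × ℝ => Θ n x.1 x.2) (Set.Ioo 0 1 ×ˢ Set.Ioo 0 1)) ∧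
  (∀ n t, Monotone (fun p => Θ n p t)) ∧
  (∀ n p, Monotone (fun t => Θ n p t)) ∧
  (∀ p t, Antitone (fun n => Θ n p t)) ∧
  (∀ n p t, 0 ≤ Θ n p t ∧ Θ n p t ≤ 1) ∧
  (∀ n, 1 ≤ n → ∀ p ∈ Set.Ioo (0 : ℝ) 1, ∀ t ∈ Set.Ioo (0 : ℝ) 1, 0 < deriv (fun q => Θ n q t) p) ∧
  ContinuousOn pc (Set.Ioo 0 1) ∧
  (∀ t ∈ Set.Ioo (0 : ℝ) 1, 0 < pc t ∧ pc t < 1)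

/-- The K⁺ shape (SupercritExchangeUniformity with the percolation `let`s replaced by abstract data). -/
def SupShape (Θ : ℕ → ℝ → ℝ → ℝ) (pc : ℝ → ℝ) : Prop :=
  ∀ lo hi : ℝ, 0 < lo → lo < hi → hi < 1 → ∃ ρ > (0 : ℝ), ∃ L : ℝ, ∃ a : ℝ → ℝ → ℝ,
    ContinuousOn (fun x : ℝ × ℝ => a x.1 x.2)
        {x : ℝ × ℝ | x.2 ∈ Set.Icc lo hi ∧ pc x.2 ≤ x.1 ∧ x.1 ≤ pc x.2 + ρ} ∧
      (∀ t ∈ Set.Icc lo hi, ∀ p q : ℝ, pc t ≤ p → p ≤ pc t + ρ → pc t ≤ q → q ≤ pc t + ρ →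
        |a p t - a q t| ≤ L * |p - q|) ∧
      ∀ η > (0 : ℝ), ∃ m : ℕ, ∀ n ≥ m, ∀ t ∈ Set.Icc lo hi, ∀ p : ℝ, pc t ≤ p → p ≤ pc t + ρ →
        |deriv (fun s => Θ n p s) t - a p t * deriv (fun q => Θ n q t) p| ≤
          η * deriv (fun q => Θ n q t) p

/-- The K⁻ shape (SubcritExchangeUniformity over abstract data). -/
def SubShape (Θ : ℕ → ℝ → ℝ → ℝ) (pc : ℝ → ℝ) : Prop :=
  ∀ lo hi : ℝ, 0 < lo → lo < hi → hi < 1 → ∃ σ : ℝ → ℝ,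
    ContinuousOn σ (Set.Icc lo hi) ∧
      ∀ η > (0 : ℝ), ∃ δ > (0 : ℝ), ∃ m : ℕ, ∀ n ≥ m, ∀ t ∈ Set.Icc lo hi, ∀ p : ℝ,
        pc t - δ ≤ p → p ≤ pc t →
        |deriv (fun s => Θ n p s) t - σ t * deriv (fun q => Θ n q t) p| ≤
          η * deriv (fun q => Θ n q t) p

/-- Curve invariance of the critical jump `t ↦ θ (pc t) t` on compact sub-arcs (the conclusion of
`curveInvariance_core`; the crux is this for the percolation family). -/
def Invariant (θ : ℝ → ℝ → ℝ) (pc : ℝ → ℝ) : Prop :=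
  ∀ lo hi : ℝ, 0 < lo → lo < hi → hi < 1 → ∀ t ∈ Set.Icc lo hi, θ (pc t) t = θ (pc hi) hi

/-- What the proved core gives (statement only; its proof is `curveInvariance_core` fed with the
three proved stubs of `Lines/max_reparam.lean`). -/
def CoreStatement : Prop :=
  ∀ (Θ : ℕ → ℝ → ℝ → ℝ) (θ : ℝ → ℝ → ℝ) (pc : ℝ → ℝ),
    CoreHypotheses Θ θ pc → SupShape Θ pc → SubShape Θ pc → TransportLemma → Invariant θ pc

/-- **Tightness 1 (target for the disprover).** Without the K⁻ shape the core fails: witnessed on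
paper by the travelling wave `Θ_n(p,t) = J(t)·Ψ(n(p − pc t)) + n⁻¹ s₁ h(n(p − pc t))` with
`J′ > 0` (report §3(b)): every clause of `CoreHypotheses` and `SupShape` holds (with
`a⁺ = −pc′ + J′/s₁`), `Invariant` fails.  Once `TransportLemma` (stmt-16063) is a theorem this
reads "any proof of the core must use hSub". -/
def CoreNeedsSub : Prop :=
  ¬ ∀ (Θ : ℕ → ℝ → ℝ → ℝ) (θ : ℝ → ℝ → ℝ) (pc : ℝ → ℝ),
      CoreHypotheses Θ θ pc → SupShape Θ pc → Invariant θ pc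

/-- **Tightness 2 (mirror).** Without the K⁺ shape the core fails (same wave, smoothing of the
supercritical ramp moved to the right of the curve so that the boundary layer sits above it). -/
def CoreNeedsSup : Prop :=
  ¬ ∀ (Θ : ℕ → ℝ → ℝ → ℝ) (θ : ℝ → ℝ → ℝ) (pc : ℝ → ℝ),
      CoreHypotheses Θ θ pc → SubShape Θ pc → Invariant θ pc

/-- **Consistency with a jump (sanity of the route's logic).** The core's hypotheses with BOTH
shapes are satisfiable together with a positive critical jump (travelling wave with constant
`J = 1/2`: exchange rate `≡ −pc′` exactly, report §3(a)).  Hence K⁺ ∧ K⁻ do not presuppose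
continuity; only the planar anchor empties the jump. -/
def CoreAdmitsJump : Prop :=
  ∃ (Θ : ℕ → ℝ → ℝ → ℝ) (θ : ℝ → ℝ → ℝ) (pc : ℝ → ℝ),
    CoreHypotheses Θ θ pc ∧ SupShape Θ pc ∧ SubShape Θ pc ∧ ∃ t ∈ Set.Ioo (0 : ℝ) 1, 0 < θ (pc t) t

end Summit.CriticalPhenomena.PercolationContinuityZ3.Cruxes.CurveInvariance.Ideator2
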